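import Summits.AnomalousDissipation.AnomalousDissipation.Theorems.EnsembleRigidityDefs
import Summits.AnomalousDissipation.AnomalousDissipation.Theorems.EnsembleRigidityGPMeanBoundedFamilyStubHeadCoefficients
import Literature.Analysis.FunctionSpaces.TorusFluidGlueProofs
import Literature.Analysis.FunctionSpaces.TorusTrigPoly

/-!
# Stub `stub_energyWorkLawGP` (S4) of line `Sketch` (crux stmt-AnomalousDissipation-15151,
  `VirtualDissipation.LightSteadyStatesGP`)

Laws of the `G`-symmetric mean-zero classical steady states `(u, p)` of `NS_ν(f_GP)`, `ν > 0`
(`f_GP = gpForce`, the Galloway–Proctor force), GIVEN the pinning of the forcing shell (stub S3 of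
the line, taken as hypothesis verbatim: `P₁u = (2/3)(f_GP, u)·f_GP` for every smooth solenoidal
mean-zero `G`-symmetric field `u`, `P₁ = Torus.fourierTruncate 1`):

* WORK = DISSIPATION `(f_GP, u) = ν‖∇u‖₂²` (`StubEnergyWorkLaw.integral_inner_eq_dissipation_of_steady`):
  a steady state is a time-constant classical solution `IsClassicalNSSolutionOn univ`; its kinetic
  energy is constant in time, and by the energy balance
  `Torus.IsClassicalNSSolutionOn.energy_balance_holds` (Doering–Foias 2002 §2 (2.4): test the
  momentum equation with `u`, `∫⟪(u·∇)u, u⟫ = 0`, `∫⟪Δu, u⟫ = −‖∇u‖₂²`, `∫⟪∇p, u⟫ = 0`) the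
  derivative `−ν‖∇u‖₂² + (f_GP, u)` of that constant vanishes;
* ENERGY–WORK LAW `∫‖P₁u‖² = (2/3)(ν‖∇u‖₂²)²`: by pinning `P₁u = c·f_GP` with
  `c = (2/3)(f_GP, u) = (2/3)ν‖∇u‖₂²`, and `∫‖f_GP‖² = 3/2`
  (`GPMeanBoundedFamily.StubHeadCoefficients.integral_norm_sq_gpForce`), so
  `∫‖P₁u‖² = c²·(3/2) = (2/3)(ν‖∇u‖₂²)²`.

Smoothness and solenoidality of `u` are read off the structure `IsClassicalNSSolutionOn`
(`smooth_velocity.isSmooth_slice`, `divFree`).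
-/

noncomputable section

-- every `Summit.AnomalousDissipation.AnomalousDissipation.…` name repeats the summit = sub-problem segment (D-0017 layout)
set_option linter.dupNamespace false

namespace Summit.AnomalousDissipation.AnomalousDissipation.Theorems.VirtualDissipation.LightSteadyStatesGP

open MeasureTheory Filter Topology UnitAddTorus
open scoped InnerProductSpace ENNReal
open Literature.Analysis.FunctionSpaces Literature.Analysis.FluidPDE
open Summit.AnomalousDissipation.AnomalousDissipation.Theorems.EnsembleRigidity

namespace StubEnergyWorkLaw

-- adapted from Summits/.../Theorems/CoherentStatesSteadyNegTameOffThinSets.lean (`steady_energy_identity`)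
/-- **Steady work = dissipation.** For a steady classical solution of `NS_ν(f)` on `T^d` (a
time-constant `IsClassicalNSSolutionOn univ`), `∫⟪f, u⟫ = ν‖∇u‖₂²`: the kinetic energy is constant
in time, and its derivative is `−ν‖∇u‖₂² + ∫⟪f, u⟫` by the energy balance
`Torus.IsClassicalNSSolutionOn.energy_balance_holds` (Doering–Foias 2002 §2 (2.4);
Foias–Manley–Rosa–Temam 2001 p. 101 (12.39)). [folklore] -/
theorem integral_inner_eq_dissipation_of_steady {d : Type*} [Fintype d] [DecidableEq d] {ν : ℝ}
    {f u : UnitAddTorus d → EuclideanSpace ℝ d} {p : UnitAddTorus d → ℝ}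
    (h : Torus.IsClassicalNSSolutionOn Set.univ ν (fun _ => f) (fun _ => u) (fun _ => p)) :
    ∫ x, ⟪f x, u x⟫_ℝ = ν * Torus.gradNormSq u := by
  have hd := Torus.IsClassicalNSSolutionOn.energy_balance_holds h convex_univ (Set.mem_univ (0 : ℝ))
  rw [hasDerivWithinAt_univ] at hd
  have h0 : HasDerivAt (fun _ : ℝ => Torus.kineticEnergy u) (0 : ℝ) (0 : ℝ) := hasDerivAt_const _ _
  have := h0.unique hd
  linarith

/-- `∫‖c • f_GP‖² = c²·(3/2)`, from `∫‖f_GP‖² = 3/2`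
(`GPMeanBoundedFamily.StubHeadCoefficients.integral_norm_sq_gpForce`). [folklore] -/
theorem integral_norm_sq_smul_gpForce (c : ℝ) :
    ∫ x, ‖(c • gpForce) x‖ ^ 2 = c ^ 2 * (3 / 2) := by
  have h : ∀ x, ‖(c • gpForce) x‖ ^ 2 = c ^ 2 * ‖gpForce x‖ ^ 2 := fun x => by
    rw [Pi.smul_apply, norm_smul, mul_pow, Real.norm_eq_abs, sq_abs]
  simp_rw [h, integral_const_mul, GPMeanBoundedFamily.StubHeadCoefficients.integral_norm_sq_gpForce]

end StubEnergyWorkLaw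

open StubEnergyWorkLaw in
/-- **S4 `stub_energyWorkLawGP`** — given pinning (S3, hypothesis verbatim): for every `G`-symmetric
mean-zero classical steady state `(u, p)` of `NS_ν(f_GP)`, `ν > 0`, WORK = DISSIPATION
`(f_GP, u) = ν‖∇u‖²` (momentum equation tested with `u`: `∫⟪(u·∇)u, u⟫ = 0`, `∫⟪Δu, u⟫ = −‖∇u‖²`,
`∫⟪∇p, u⟫ = 0`) and the ENERGY–WORK LAW `∫|P₁u|² = (2/3)(ν‖∇u‖²)²` (`P₁u = (2/3)(f_GP,u) f_GP`,
`∫|f_GP|² = 3/2`). [folklore] -/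
theorem stub_energyWorkLawGP :
    (∀ u : UnitAddTorus (Fin 3) → EuclideanSpace ℝ (Fin 3), Torus.IsSmooth u → Torus.IsDivFree u →
      Torus.HasZeroMean u → IsGPSymmetric u →
      Torus.fourierTruncate 1 u = ((2 : ℝ) / 3 * ∫ x, ⟪gpForce x, u x⟫_ℝ) • gpForce) →
    ∀ (ν : ℝ) (u : UnitAddTorus (Fin 3) → EuclideanSpace ℝ (Fin 3)) (p : UnitAddTorus (Fin 3) → ℝ),
      0 < ν → Torus.IsClassicalNSSolutionOn Set.univ ν (fun _ => gpForce) (fun _ => u) (fun _ => p) →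
      Torus.HasZeroMean u → IsGPSymmetric u →
      (∫ x, ⟪gpForce x, u x⟫_ℝ = ν * Torus.gradNormSq u) ∧
      ∫ x, ‖Torus.fourierTruncate 1 u x‖ ^ 2 = (2 : ℝ) / 3 * (ν * Torus.gradNormSq u) ^ 2 := by
  intro hpin ν u p _hν hsol hmean hsym
  have hwork : ∫ x, ⟪gpForce x, u x⟫_ℝ = ν * Torus.gradNormSq u :=
    integral_inner_eq_dissipation_of_steady hsol
  refine ⟨hwork, ?_⟩
  have hus : Torus.IsSmooth u := hsol.smooth_velocity.isSmooth_slice (Set.mem_univ (0 : ℝ))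
  have hud : Torus.IsDivFree u := hsol.divFree 0 (Set.mem_univ _)
  rw [hpin u hus hud hmean hsym, integral_norm_sq_smul_gpForce, hwork]
  ring

end Summit.AnomalousDissipation.AnomalousDissipation.Theorems.VirtualDissipation.LightSteadyStatesGP

end
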